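import Summits.NavierStokesRegularity.NavierStokesRegularity.Theorems.ScenarioCensusScrewBlowdownLP
import HarnessLib

/-!
# LINE «screw-blowdown» port, part 12/13: v1.9 — S3 `VanishingBlowdownLiouville` PROVED (compactness + `LocalPersistence` + small-constant Liouville),
# `row_ArecT_proved` (A-rec-T DECIDED), `hasVanishingBlowdown_iff_eq_zero`, `typeIAncientLiouville_iff_blowdownLimits_vanish`, `row_status_v1_9`

Re-homed for the scenario census (typer seat ns-census-typer-1 g7; lead g9 RULINGS [7] 20:33Z / [8] 21:03Z / [12](b) 21:58Z: «screw-blowdown v1.8 =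
version of record; `Row_A13isqT` DECIDED IN KERNEL → CANDIDATE-DECIDED member under A13 (row already TREE); typer-1 slot 3 port of record =
`ScrewBlowdown_port_v1_8.lean` bb5f719a8be448dd (stub-free)»; lead g10 RULINGS [1](b) 22:36Z / [2] 22:42Z: «port v1.9 ffe1ad3d1d25e376 = port of record (idea-crit-3 DIFF-CHECK 22:40:40Z CONFORMS); slot 4 = its S3
appendix ADMISSIBLE after slot 3»; ref PRE-CHECKs items 13 / 15 / 20 / 27): VERBATIM PORT of ns-idea-4 LINE g12-1 «screw-blowdown» PORT copy
`pub/ideators/ns-idea-4/lines/screw-blowdown/port/ScrewBlowdown_port_v1_9.lean` sha16 ffe1ad3d1d25e376 (2890 l.; lean check rc 0, 0 sorry; = the v1.8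
port copy bb5f719a8be448dd as a literal prefix — itself the v1.7 copy 674e939b7b0b34e8 + the `LocalPersistence` attack appendix `…LP` + the consequences
`localPersistence_holds` / `farPastSpreading_holds` / `linearConeLiouville_holds` / `row_A13isqT_proved` — plus the v1.9 S3 block: `vanishingBlowdownLiouville_holds`,
`row_ArecT_proved`; parts 1–3 landed while v1.8 was the copy of record, text identical),
split for the 400-line rule into `ScenarioCensusScrewBlowdown` (§1–§3: objects, the cell `Row_A13isqT`, obligation Props, S1 PROVED) →
`…Plumbing` (§4, S2 PROVED) → `…Bridges` (§5 + v1.3) → `…Recurrent` (v1.4, `Row_ArecT`) → `…OffAxis` (v1.5 a) → `…Cone` (v1.5 b: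
`farPast_linearCone_smallness_of_screw`) → `…Residual` (v1.5 c + v1.6: `LinearConeLiouville`, DSS rungs) → `…Propagation` (v1.7: FS, LP,
reductions; the three class-general tools are NOT re-declared — taken BY NAME, general `E`, from `Theorems/TypeIAncientMildForwardUniqueness.lean`,
ns-idea-4 extract a1b589f6dec7da83, p671177) → `…LPTools` / `…LPDuhamel` / `…LP` (the appendix: Gaussian locality, the three-term Oseen split,
time weights; `duhamel_bound`; the bootstrap `one_step` / `persist` / `localPersistence` + the consequences incl. `row_A13isqT_proved`) →
`…Vanishing` (v1.9: S3 proved, `row_ArecT_proved`) → `…Keys` (census keys `Row_A13isqT` / `Row_ArecT` + `_excluded`).  Lean text VERBATIM in namespaces `…Theorems.ScenarioCensus.ScrewBlowdown` / `…ScrewBlowdownLP` (the line's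
`…Lines.ScrewBlowdownPort` / `…PortLP` re-homed; qualified references renamed accordingly); port edits: `local notation "E3"` → `abbrev E3` (the
appendix `open`s it), `@[conjecture]` on `VanishingBlowdownLiouville` only (part 1 landed while S3 was open; an obligation node, now with the closed
witness `vanishingBlowdownLiouville_holds`), seven one-line docstrings added, `continuous_rotZ_angle'` not re-declared (it restates the tree's
`Literature.Analysis.FluidPDE.continuous_rotZ_angle`, gate lint `dedup.landed`; its uses renamed), the line's `set_option linter.unusedVariables false` dropped (five proof lambdas
bind the unused `θ₀ h` as `_ _`; the unused hypothesis binders of `hasVanishingBlowdown_of_axiallyRecurrent` / `pointwise_small_of_zoom_small` are spelled `_hu` / `_hΛ`,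
statements otherwise identical); `set_option maxHeartbeats … in` of the appendix kept as in the line.

No census VALUE is moved by this file (row A13 is TREE already; the lead books the member A13isq-T); NS regularity is NOT proved; (L′)
`SymmetryModuliCount.TypeIAncientLiouville` is untouched (hypothesis of bridges only); no summit statement is proved by this file.
-/

-- the summit and its single problem share the name `NavierStokesRegularity` (D-0017 nested layout)
set_option linter.dupNamespace false

namespace Summit.NavierStokesRegularity.NavierStokesRegularity.Theorems.ScenarioCensus.ScrewBlowdown

open Set Function Filter Topology
open Literature.Analysis Literature.Analysis.FluidPDE
open Summit.NavierStokesRegularity.NavierStokesRegularity.Theorems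

open Set Function Filter Topology
open Literature.Analysis Literature.Analysis.FluidPDE
open Summit.NavierStokesRegularity.NavierStokesRegularity.Theorems

-- (`E3` = the abbrev of part 1, same namespace)

/-- v1.8 record (kept for parity with the line file; SUPERSEDED below by `row_ArecT_proved`): `Row_ArecT ⇐ S3`, and the screw row. -/
theorem row_ArecT_status : (VanishingBlowdownLiouville → Row_ArecT) ∧ Row_A13isqT :=
  ⟨row_ArecT_of_vanishingBlowdownLiouville, row_A13isqT_proved⟩

/-! ## port v1.9 — S3 `VanishingBlowdownLiouville` PROVED (ns-idea-4 g13; identical decl for decl to the v1.9 closing block minus `stub_vanishingBlowdownLiouville` / `row_A13isqT_of_registered`, `row_status_v1_9` cites `row_A13isqT_proved`; compactness + proved `LocalPersistence` + tree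
small-constant Liouville).  The file is sorry-free from this version on.

Dictionary entry of record (Giga–Kohn ↦ NS, now a THEOREM for the KNSS Type-I ancient mild class): «trivial α-limit set of
the similarity (zoom-out) flow ⇒ trivial solution».  Giga–Kohn prove it for subcritical semilinear heat with the weighted
energy; here NO Lyapunov functional is used — the substitute is LOCAL PERSISTENCE OF SMALLNESS (appendix `ScrewBlowdownLP`,
a localised KNSS bootstrap) fed by COMPACTNESS of the class. -/

/-- **Step 1 (compactness).** If every blow-down limit of `u ∈ A_C` vanishes, then the parabolic zooms `nsRescale μ u`
tend to `0` uniformly on the unit-time ball `{-1} × B(0,K)` as `μ → ∞` (full limit, not only along a sequence): by the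
tree extraction theorem a bad sequence of scales would have a blow-down limit that is non-zero somewhere on that ball. -/
theorem zoom_small_of_hasVanishingBlowdown {C : ℝ} {u : ℝ → E3 → E3} (hu : IsTypeIAncientMild C u)
    (hV : HasVanishingBlowdown C u) :
    ∀ ε > (0 : ℝ), ∀ K > (0 : ℝ), ∃ μ₀ > (0 : ℝ), ∀ μ, μ₀ ≤ μ → ∀ y : E3, ‖y‖ ≤ K →
      ‖nsRescale μ u (-1) y‖ ≤ ε := by
  intro ε hε K hK
  by_contra hbad
  push Not at hbad
  -- a bad scale beyond every threshold `n + 1`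
  have hch : ∀ n : ℕ, ∃ μ : ℝ, (n : ℝ) + 1 ≤ μ ∧ ∃ y : E3, ‖y‖ ≤ K ∧ ε < ‖nsRescale μ u (-1) y‖ := by
    intro n
    obtain ⟨μ, hμ, y, hy, hlt⟩ := hbad ((n : ℝ) + 1) (by positivity)
    exact ⟨μ, hμ, y, hy, hlt⟩
  choose μ hμge y hyK hbig using hch
  have hμpos : ∀ n, 0 < μ n := fun n => by linarith [hμge n, (Nat.cast_nonneg n : (0:ℝ) ≤ n)]
  have hμlim : Tendsto μ atTop atTop := by
    refine tendsto_atTop_atTop.2 fun b => ⟨Nat.ceil b, fun n hn => ?_⟩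
    have h1 : (b : ℝ) ≤ Nat.ceil b := Nat.le_ceil b
    have h2 : (Nat.ceil b : ℝ) ≤ n := by exact_mod_cast hn
    linarith [hμge n]
  -- extract a blow-down limit along a subsequence
  obtain ⟨φ, hφ, W, hW, -, -, hloc, -⟩ :=
    exists_tendsto_of_isTypeIAncientMild_seq C (w := fun k => nsRescale (μ k) u)
      fun k => isTypeIAncientMild_nsRescale hu (hμpos k)
  have hBD : IsBlowdownLimit C u W :=
    ⟨hW, fun k => μ (φ k), fun k => hμpos _, hμlim.comp hφ.tendsto_atTop, fun t ht => hloc t ht⟩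
  have hW0 : ∀ x, W (-1) x = 0 := hV W hBD (-1) (by norm_num)
  -- uniform convergence on the compact ball `B(0,K)` at time `-1`
  have hK' : IsCompact (Metric.closedBall (0 : E3) K) := isCompact_closedBall _ _
  have hunif : TendstoUniformlyOn (fun j => nsRescale (μ (φ j)) u (-1)) (W (-1)) atTop
      (Metric.closedBall (0 : E3) K) :=
    (tendstoLocallyUniformlyOn_iff_tendstoUniformlyOn_of_compact hK').1
      ((hloc (-1) (by norm_num)).tendstoLocallyUniformlyOn)
  have hev := (Metric.tendstoUniformlyOn_iff.1 hunif) ε hε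
  obtain ⟨j, hj⟩ := hev.exists
  have hyj : y (φ j) ∈ Metric.closedBall (0 : E3) K := by
    rw [Metric.mem_closedBall, dist_zero_right]; exact hyK _
  have h1 := hj (y (φ j)) hyj
  rw [hW0, dist_zero_left] at h1
  exact absurd h1 (not_lt.2 (hbig (φ j)).le)

/-- **Step 2a (one LP step, the geometric remark).**  If the `μ`-zoom of `u` is `ε`-small on the unit-time ball
`{-1} × B(0, Λ+1)` and `μ ≥ ‖x‖`, `μ ≥ √(−2t)`, then the LP test ball `B(x, Λμ)` at the quiet time `s₀ = −μ²` lies inside the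
small region `B(0,(Λ+1)μ)`, so `LocalPersistence` (in the unpacked form `hP`) gives `√(−t)‖u(t,x)‖ ≤ ε′`.  The quiet ball may be
centred ANYWHERE — this is why S3 needs no symmetry and no axis. -/
theorem pointwise_small_of_zoom_small {C ε' ε Λ : ℝ}
    (hP : ∀ (u : ℝ → E3 → E3), IsTypeIAncientMild C u →
      ∀ (s₀ t : ℝ) (x : E3) (R : ℝ), s₀ ≤ 2 * t → t < 0 → Λ * Real.sqrt (-s₀) ≤ R →
        (∀ x' : E3, dist x' x ≤ R → Real.sqrt (-s₀) * ‖u s₀ x'‖ ≤ ε) → Real.sqrt (-t) * ‖u t x‖ ≤ ε')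
    (_hΛ : 0 < Λ) {u : ℝ → E3 → E3} (hu : IsTypeIAncientMild C u) {μ : ℝ} (hμ0 : 0 < μ) {t : ℝ} (ht : t < 0)
    {x : E3} (hxμ : ‖x‖ ≤ μ) (htμ : Real.sqrt (-(2 * t)) ≤ μ)
    (hz : ∀ y : E3, ‖y‖ ≤ Λ + 1 → ‖nsRescale μ u (-1) y‖ ≤ ε) :
    Real.sqrt (-t) * ‖u t x‖ ≤ ε' := by
  have hsq0 : 0 ≤ Real.sqrt (-(2 * t)) := Real.sqrt_nonneg _
  set s₀ : ℝ := -(μ ^ 2) with hs₀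
  have hsqrt_s₀ : Real.sqrt (-s₀) = μ := by
    rw [hs₀, neg_neg, Real.sqrt_sq hμ0.le]
  have hs₀t : s₀ ≤ 2 * t := by
    have h2 : Real.sqrt (-(2 * t)) ^ 2 ≤ μ ^ 2 := pow_le_pow_left₀ hsq0 htμ 2
    rw [Real.sq_sqrt (by linarith)] at h2
    rw [hs₀]; linarith
  have hΛR : Λ * Real.sqrt (-s₀) ≤ Λ * μ := by rw [hsqrt_s₀]
  have hball : ∀ x' : E3, dist x' x ≤ Λ * μ → Real.sqrt (-s₀) * ‖u s₀ x'‖ ≤ ε := by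
    intro x' hx'
    -- `x' = μ • y` with `‖y‖ ≤ Λ + 1`
    set y : E3 := μ⁻¹ • x' with hy
    have hyx : μ • y = x' := by rw [hy, smul_smul, mul_inv_cancel₀ hμ0.ne', one_smul]
    have hx'n : ‖x'‖ ≤ ‖x‖ + Λ * μ := by
      have := norm_le_norm_add_norm_sub' x' x
      rw [← dist_eq_norm] at this
      linarith
    have hyn : ‖y‖ ≤ Λ + 1 := by
      rw [hy, norm_smul, norm_inv, Real.norm_eq_abs, abs_of_pos hμ0]
      rw [inv_mul_le_iff₀ hμ0]
      nlinarith [hxμ, hx'n, _hΛ]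
    have h1 := hz y hyn
    have e1 : nsRescale μ u (-1) y = μ • u s₀ x' := by
      simp only [nsRescale, hyx, hs₀, mul_neg, mul_one]
    rw [e1, norm_smul, Real.norm_eq_abs, abs_of_pos hμ0] at h1
    rw [hsqrt_s₀]
    exact h1
  exact hP u hu s₀ t x (Λ * μ) hs₀t ht hΛR hball

/-- **Step 2 (persistence).** The proved `LocalPersistence` turns the far-past zoom smallness into GLOBAL relative
smallness: apply step 2a at the scale `μ = μ₀ + √(−2t) + ‖x‖`. -/
theorem small_everywhere_of_hasVanishingBlowdown {C : ℝ} {u : ℝ → E3 → E3}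
    (hu : IsTypeIAncientMild C u) (hV : HasVanishingBlowdown C u) :
    ∀ ε' > (0 : ℝ), ∀ t < (0 : ℝ), ∀ x : E3, Real.sqrt (-t) * ‖u t x‖ ≤ ε' := by
  intro ε' hε' t ht x
  obtain ⟨ε, hε, Λ, hΛ, hP⟩ := localPersistence_holds C ε' hε'
  obtain ⟨μ₀, hμ₀, hz⟩ := zoom_small_of_hasVanishingBlowdown hu hV ε hε (Λ + 1) (by linarith)
  have hsq0 : 0 ≤ Real.sqrt (-(2 * t)) := Real.sqrt_nonneg _
  have hx0 : 0 ≤ ‖x‖ := norm_nonneg _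
  exact pointwise_small_of_zoom_small hP hΛ hu (μ := μ₀ + Real.sqrt (-(2 * t)) + ‖x‖) (by linarith) ht
    (by linarith) (by linarith) (hz _ (by linarith))

/-- **S3 HOLDS — `VanishingBlowdownLiouville`** (v1.9): a KNSS-gauge Type-I ancient mild field all of whose blow-down
limits vanish is identically zero.  Proof: global relative smallness below the KNSS threshold `1/(8 C₀)` (steps 1–2) and
the tree small-constant Liouville `ExtremalTypeIConstant.SmallConstantLiouville.smallConstantLiouville_eq_zero` BY NAME. -/
theorem vanishingBlowdownLiouville_holds : VanishingBlowdownLiouville := by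
  intro C u hu hV
  have hC₀ : 0 < oseenSliceConst E3 := oseenSliceConst_pos
  set A : ℝ := 1 / (16 * oseenSliceConst E3) with hAdef
  have hA0 : 0 < A := by rw [hAdef]; positivity
  have hA : A < 1 / (8 * oseenSliceConst E3) := by
    rw [hAdef]
    gcongr
    linarith
  have hsmall := small_everywhere_of_hasVanishingBlowdown hu hV A hA0
  have hA' : ∀ τ < (0 : ℝ), ∀ y, ‖u τ y‖ ≤ A / Real.sqrt (-τ) := by
    intro τ hτ y
    have hs : 0 < Real.sqrt (-τ) := Real.sqrt_pos.2 (by linarith)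
    rw [le_div_iff₀ hs, mul_comm]
    exact hsmall τ hτ y
  intro t ht x
  exact smallConstantLiouville_eq_zero (isTypeIAncientMild_of_decay hu hA') hA ht x

/-- **Row A-rec-T — DECIDED in kernel (v1.9; this standalone file; standard axioms; not a tree file, not landed).**
A KNSS-gauge Type-I ancient mild field that is AXIALLY RECURRENT modulo rotations in the Type-I gauge
(`IsAxiallyRecurrent`, v1.4 — it contains every irrational-screw-equivariant field) vanishes identically:
`Row_ArecT ⇐ S3` (v1.4, `row_ArecT_of_vanishingBlowdownLiouville`) and S3 holds.  (L′) `TypeIAncientLiouville`, every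
other census row and the summit are untouched. -/
theorem row_ArecT_proved : Row_ArecT := row_ArecT_of_vanishingBlowdownLiouville vanishingBlowdownLiouville_holds

/-- **Quotable corollary (contrapositive of S3): every NON-ZERO Type-I ancient mild field has a NON-ZERO blow-down
limit in its own class `A_C`.**  Any attack on (L′) may therefore assume, at no cost, that the candidate is a
blow-down limit of a class member and is non-trivial at unit scale. -/
theorem exists_nonzero_blowdownLimit {C : ℝ} {u : ℝ → E3 → E3}
    (hu : IsTypeIAncientMild C u) (hne : ∃ t < (0 : ℝ), ∃ x, u t x ≠ 0) :
    ∃ W, IsBlowdownLimit C u W ∧ ∃ t < (0 : ℝ), ∃ x, W t x ≠ 0 := by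
  by_contra h
  push Not at h
  have hV : HasVanishingBlowdown C u := fun W hW t ht x => h W hW t ht x
  obtain ⟨t, ht, x, hx⟩ := hne
  exact hx (vanishingBlowdownLiouville_holds C u hu hV t ht x)

/-- **Non-zero class members are SUBSTANTIAL AT ALL LARGE SCALES** (v1.9; constants depend on `C` only): there are
`ε_C, K_C > 0` such that every non-zero `u ∈ A_C` satisfies `sup_{‖y‖ ≤ K_C} ‖(nsRescale μ u)(−1, y)‖ > ε_C` for ALL `μ ≥ μ₁(u)`.
(If the zoom were `ε`-small on `B(0,K_C)` along scales `μ_k → ∞`, step 2a would make `u` small at every point, hence zero.)  This is the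
normal form the line hands to any attack on (L′): a counterexample is uniformly non-degenerate towards the far past / large scales. -/
theorem substantial_at_large_scales (C : ℝ) :
    ∃ ε > (0 : ℝ), ∃ K > (0 : ℝ), ∀ (u : ℝ → E3 → E3), IsTypeIAncientMild C u → (∃ t < (0 : ℝ), ∃ x, u t x ≠ 0) →
      ∃ μ₁ > (0 : ℝ), ∀ μ, μ₁ ≤ μ → ∃ y : E3, ‖y‖ ≤ K ∧ ε < ‖nsRescale μ u (-1) y‖ := by
  have hC₀ : 0 < oseenSliceConst E3 := oseenSliceConst_pos
  set A : ℝ := 1 / (16 * oseenSliceConst E3) with hAdef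
  have hA0 : 0 < A := by rw [hAdef]; positivity
  have hA : A < 1 / (8 * oseenSliceConst E3) := by
    rw [hAdef]
    gcongr
    linarith
  obtain ⟨ε, hε, Λ, hΛ, hP⟩ := localPersistence_holds C A hA0
  refine ⟨ε, hε, Λ + 1, by linarith, fun u hu hne => ?_⟩
  by_contra hbad
  push Not at hbad
  -- `hbad : ∀ μ₁ > 0, ∃ μ, μ₁ ≤ μ ∧ ∀ y, ‖y‖ ≤ Λ + 1 → ‖nsRescale μ u (-1) y‖ ≤ ε`
  have hsmall : ∀ t < (0 : ℝ), ∀ x : E3, Real.sqrt (-t) * ‖u t x‖ ≤ A := by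
    intro t ht x
    have hsq0 : 0 ≤ Real.sqrt (-(2 * t)) := Real.sqrt_nonneg _
    have hx0 : 0 ≤ ‖x‖ := norm_nonneg _
    obtain ⟨μ, hμge, hz⟩ := hbad (Real.sqrt (-(2 * t)) + ‖x‖ + 1) (by linarith)
    exact pointwise_small_of_zoom_small hP hΛ hu (μ := μ) (by linarith) ht (by linarith) (by linarith) hz
  have hA' : ∀ τ < (0 : ℝ), ∀ y, ‖u τ y‖ ≤ A / Real.sqrt (-τ) := by
    intro τ hτ y
    have hs : 0 < Real.sqrt (-τ) := Real.sqrt_pos.2 (by linarith)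
    rw [le_div_iff₀ hs, mul_comm]
    exact hsmall τ hτ y
  obtain ⟨t, ht, x, hx⟩ := hne
  exact hx (smallConstantLiouville_eq_zero (isTypeIAncientMild_of_decay hu hA') hA ht x)

/-- For a class member, «all blow-down limits vanish» is EQUIVALENT to «the field vanishes» (⇒ is S3; ⇐ because a
blow-down limit of the zero field is a locally uniform limit of zero slices). -/
theorem hasVanishingBlowdown_iff_eq_zero {C : ℝ} {u : ℝ → E3 → E3} (hu : IsTypeIAncientMild C u) :
    HasVanishingBlowdown C u ↔ ∀ t < (0 : ℝ), ∀ x, u t x = 0 := by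
  refine ⟨fun hV => vanishingBlowdownLiouville_holds C u hu hV, fun h0 W hW t ht x => ?_⟩
  obtain ⟨-, μ, hμpos, -, hloc⟩ := hW
  have hzero : ∀ k, nsRescale (μ k) u t = fun _ => (0 : E3) := by
    intro k
    funext y
    have hneg : (μ k) ^ 2 * t < 0 := mul_neg_of_pos_of_neg (pow_pos (hμpos k) 2) ht
    simp only [nsRescale, h0 _ hneg, smul_zero]
  have hloc' : TendstoLocallyUniformly (fun k => nsRescale (μ k) u t) (W t) atTop := hloc t ht
  have h1 : Tendsto (fun k => nsRescale (μ k) u t x) atTop (𝓝 (W t x)) :=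
    TendstoLocallyUniformlyOn.tendsto_at (s := Set.univ)
      (tendstoLocallyUniformlyOn_univ.2 hloc') (Set.mem_univ x)
  simp only [hzero] at h1
  exact tendsto_nhds_unique h1 tendsto_const_nhds

/-- **(L′) ⟺ «no class member has a non-zero blow-down limit»** — the reformulation of the rung that S3 buys: it
suffices to prove Liouville for fields that ARISE AS BLOW-DOWN LIMITS of class members (v1.9; both directions
kernel-checked; this does NOT prove (L′)). -/
theorem typeIAncientLiouville_iff_blowdownLimits_vanish :
    Summit.NavierStokesRegularity.NavierStokesRegularity.Theses.SymmetryModuliCount.TypeIAncientLiouville ↔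
      ∀ (C : ℝ) (u W : ℝ → E3 → E3), IsTypeIAncientMild C u → IsBlowdownLimit C u W →
        ∀ t < (0 : ℝ), ∀ x, W t x = 0 := by
  constructor
  · intro hL C u W hu hW t ht x
    exact hL C W (isTypeIAncientMild_iff.1 hW.1) t ht x
  · intro h C u hu t ht x
    have hu' : IsTypeIAncientMild C u := isTypeIAncientMild_iff.2 hu
    exact vanishingBlowdownLiouville_holds C u hu' (fun W hW => h C u W hu' hW) t ht x

/-- **v1.9 status of the line**: all three registered obligations are theorems, both proposed cells are decided, and
the bridge from (L′) is recorded; (L′) itself is NOT proved. -/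
theorem row_status_v1_9 :
    SyndeticReturn ∧ BlowdownEnhancement ∧ VanishingBlowdownLiouville ∧ Row_A13isqT ∧ Row_ArecT ∧
      (Summit.NavierStokesRegularity.NavierStokesRegularity.Theses.SymmetryModuliCount.TypeIAncientLiouville →
        Row_ArecT) :=
  ⟨stub_syndeticReturn, stub_blowdownEnhancement stub_syndeticReturn, vanishingBlowdownLiouville_holds,
    row_A13isqT_proved, row_ArecT_proved, row_ArecT_of_typeIAncientLiouville⟩

end Summit.NavierStokesRegularity.NavierStokesRegularity.Theorems.ScenarioCensus.ScrewBlowdown
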